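import Summits.ResolutionOfSingularities.ResolutionOfSingularities.Theorems.FrobeniusLadderFInjectiveMacaulayficationCNChartClauseRelOpen
import Summits.ResolutionOfSingularities.ResolutionOfSingularities.Theorems.FrobeniusLadderFInjectiveMacaulayficationBlowupFiModelOfCoverOpen
import HarnessLib

/-!
# (H3-rel, OPEN-RESTRICTED, face data over the open) the CN engine relative to a coordinate stratum over `D(h̄)` — ticket M2, amended per R12.16
# (crux `FInjectiveMacaulayfication` stmt-ResolutionOfSingularities-15315, chain w45a; R12.2 (iii); owner res-L1-w45a-lead-1 gen 4)

[OURS · L1 W4.5a] Support file (`--supports stmt-ResolutionOfSingularities-15315 --as helper`) for the crux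
`FrobeniusLadder.FInjectiveMacaulayfication`; NOT a statement of any manuscript; AI-written, weaker than expert review.

The relative CN engine `CNConeFiModelRel.cnConeFiModelRel` (res-D-pv-017 AS res-L1-w45a-stub-5, p497132) asks the Cohen–Macaulay +
Frobenius-closed clause at EVERY maximal ideal of `R = k[X]/(f)` off the stratum `V(X_J)`. On the f_cusp/𝔽₃ road (stub-2's scoping
memo, move 2) this fails: the `Γ`-lines meet the other bad curve `C̃′`. Here the engine is restricted to a basic open `D(h̄)`: `hoff`
is asked only at maximal ideals off `V(X_J)` AND missing `h̄`; the Cartier–Newton face data are unchanged (they are global algebraic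
conditions on the initial forms of `f`); and the conclusion is the clause (domain, every system of parameters weakly regular with
Frobenius-closed ideal) at EVERY STALK of the blow-up `affineBlowup (I_A R)` lying over `D(h̄)`. Proof = the original proof with
the glue E6‴ replaced by its open-restricted form `BlowupFiModelOfCoverOpen.blowupClause_over_basicOpen` and the Jacobson step off
the centre choosing a maximal ideal missing `x̄ⱼ · h̄`. Decls: `cnConeFiModelRelOpenH_of_chartClause` (core; the exceptional chart clause `hon` is asked only at maximal ideals missing `h̄/1`, R12.16a (ii)), `cnConeFiModelRelOpenH` (the open's equation is a POLYNOMIAL binder `h`, `h̄ = h mod f`, and the Cartier–Newton face certificates are asked only at chart points over `D(h)` — `CNChartClauseRelOpen.cnChartClauseRelOpen`, R12.16 (i)). The sibling file `CNConeFiModelRelOpen` (p518784) is the version with global face data (consumable where the faces are pure monomials, e.g. the Γ₁/Γ₃ steps).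
No definitions, no named facts. [folklore]
-/

-- single-problem summit: the doubled namespace component is forced
set_option linter.dupNamespace false

noncomputable section

open AlgebraicGeometry CategoryTheory Literature.AlgebraicGeometry.Resolution MvPolynomial

namespace Summit.ResolutionOfSingularities.ResolutionOfSingularities.Theorems.FInjectiveMacaulayfication.CNConeFiModelRelOpenH

open Summit.ResolutionOfSingularities.ResolutionOfSingularities.Theorems.FInjectiveMacaulayfication
open Literature.RingTheory.TightClosure

/-- **(G5ᴾ-rel core, OPEN-RESTRICTED, exceptional certificates over the open) THE RELATIVE MONOMIAL BLOW-UP ENGINE OVER `D(h̄)`, CORE FORM.** As `CNConeFiModelRelOpen.cnConeFiModelRelOpen_of_chartClause` (p518784) but with the exceptional chart clause `hon` asked only at the maximal ideals NOT containing `h̄/1` (R12.16a (ii)). As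
`CNConeFiModelRel.cnConeFiModelRel_of_chartClause` (res-D-pv-017 AS res-L1-w45a-stub-5, p497132): `A` a finite set of non-zero exponents
each involving a variable of `J`, `I_A` the monomial ideal it generates, vertex exponents `m_c ∈ A` whose charts cover, `(f)` prime with all
`x̄ⱼ ≠ 0`, every affine blow-up algebra `R[I_A R/x̄^{m_c}]` satisfying the Cohen–Macaulay + Frobenius-closed clause at its maximal ideals
containing `x̄^{m_c}` — EXCEPT that the clause off the stratum is asked only at the maximal ideals of `R = k[X]/(f)` off `V(X_J)` NOT
containing `h̄`, and the conclusion is the full clause (domain, Cohen–Macaulay, Frobenius-closed parameter ideals) at every stalk of the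
blow-up `affineBlowup (I_A R)` lying OVER `D(h̄)`. Proof = the original with the Jacobson step choosing a maximal ideal missing
`x̄ⱼ · h̄` and the glue `BlowupFiModelOfCoverOpen.blowupClause_over_basicOpen` (p517174). [folklore] -/
theorem cnConeFiModelRelOpenH_of_chartClause (p : ℕ) [Fact p.Prime] (k : Type) [Field k] [CharP k p] (n : ℕ) (J : Finset (Fin n))
    (A : Finset (Fin n →₀ ℕ)) (hAJ : ∀ a ∈ A, ∃ j ∈ J, 0 < a j)
    (t : ℕ) (ht : 0 < t) (m : Fin t → (Fin n →₀ ℕ)) (hm : ∀ c : Fin t, m c ∈ A)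
    (hcov : ∀ a ∈ A, ∃ (c : Fin t) (K : ℕ), 1 ≤ K ∧ ∃ y ∈ (Ideal.span ((fun b : Fin n →₀ ℕ => (MvPolynomial.monomial b (1 : k) : MvPolynomial (Fin n) k)) '' (A : Set (Fin n →₀ ℕ)))) ^ (K - 1),
      (MvPolynomial.monomial a (1 : k) : MvPolynomial (Fin n) k) ^ K = MvPolynomial.monomial (m c) 1 * y)
    (f : MvPolynomial (Fin n) k) (hfprime : (Ideal.span {f}).IsPrime)
    (hXne : ∀ v : Fin n, Ideal.Quotient.mk (Ideal.span {f}) (MvPolynomial.X v) ≠ 0)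
    (hbar : MvPolynomial (Fin n) k ⧸ Ideal.span {f})
    (hoff : ∀ (Q : Ideal (MvPolynomial (Fin n) k ⧸ Ideal.span {f})) [Q.IsMaximal],
      (∃ j ∈ J, Ideal.Quotient.mk (Ideal.span {f}) (MvPolynomial.X j) ∉ Q) → hbar ∉ Q →
      ∀ d : ℕ, ringKrullDim (Localization.AtPrime Q) = d → ∀ s : Fin d → Localization.AtPrime Q,
        (Ideal.span (Set.range s)).radical.IsMaximal →
          RingTheory.Sequence.IsWeaklyRegular (Localization.AtPrime Q) (List.ofFn s) ∧
          ∀ y : Localization.AtPrime Q, (∃ e : ℕ, y ^ p ^ e ∈ Ideal.span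
            ((fun z : Localization.AtPrime Q => z ^ p ^ e) ''
              (Ideal.span (Set.range s) : Set (Localization.AtPrime Q)))) → y ∈ Ideal.span (Set.range s))
    (hon : ∀ (c : Fin t) (Q : Ideal (blowupAlgebra (Ideal.span ((fun b : Fin n →₀ ℕ => Ideal.Quotient.mk (Ideal.span {f}) (MvPolynomial.monomial b (1 : k))) '' (A : Set (Fin n →₀ ℕ)))) (Ideal.Quotient.mk (Ideal.span {f}) (MvPolynomial.monomial (m c) 1)))) [Q.IsMaximal],
      algebraMap (MvPolynomial (Fin n) k ⧸ Ideal.span {f}) (blowupAlgebra (Ideal.span ((fun b : Fin n →₀ ℕ => Ideal.Quotient.mk (Ideal.span {f}) (MvPolynomial.monomial b (1 : k))) '' (A : Set (Fin n →₀ ℕ)))) (Ideal.Quotient.mk (Ideal.span {f}) (MvPolynomial.monomial (m c) 1))) (Ideal.Quotient.mk (Ideal.span {f}) (MvPolynomial.monomial (m c) 1)) ∈ Q →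
      algebraMap (MvPolynomial (Fin n) k ⧸ Ideal.span {f}) (blowupAlgebra (Ideal.span ((fun b : Fin n →₀ ℕ => Ideal.Quotient.mk (Ideal.span {f}) (MvPolynomial.monomial b (1 : k))) '' (A : Set (Fin n →₀ ℕ)))) (Ideal.Quotient.mk (Ideal.span {f}) (MvPolynomial.monomial (m c) 1))) hbar ∉ Q →
      ∀ d : ℕ, ringKrullDim (Localization.AtPrime Q) = d → ∀ s : Fin d → Localization.AtPrime Q,
        (Ideal.span (Set.range s)).radical.IsMaximal →
          RingTheory.Sequence.IsWeaklyRegular (Localization.AtPrime Q) (List.ofFn s) ∧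
          ∀ y : Localization.AtPrime Q, (∃ e : ℕ, y ^ p ^ e ∈ Ideal.span
            ((fun z : Localization.AtPrime Q => z ^ p ^ e) ''
              (Ideal.span (Set.range s) : Set (Localization.AtPrime Q)))) → y ∈ Ideal.span (Set.range s)) :
    ∀ y : ↥(affineBlowup (Ideal.span ((fun b : Fin n →₀ ℕ => Ideal.Quotient.mk (Ideal.span {f}) (MvPolynomial.monomial b (1 : k))) '' (A : Set (Fin n →₀ ℕ))))),
      (affineBlowup.π (Ideal.span ((fun b : Fin n →₀ ℕ => Ideal.Quotient.mk (Ideal.span {f}) (MvPolynomial.monomial b (1 : k))) '' (A : Set (Fin n →₀ ℕ))))).base y ∈ PrimeSpectrum.basicOpen hbar →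
      IsDomain ((affineBlowup (Ideal.span ((fun b : Fin n →₀ ℕ => Ideal.Quotient.mk (Ideal.span {f}) (MvPolynomial.monomial b (1 : k))) '' (A : Set (Fin n →₀ ℕ))))).presheaf.stalk y) ∧
      ∀ d : ℕ, ringKrullDim ((affineBlowup (Ideal.span ((fun b : Fin n →₀ ℕ => Ideal.Quotient.mk (Ideal.span {f}) (MvPolynomial.monomial b (1 : k))) '' (A : Set (Fin n →₀ ℕ))))).presheaf.stalk y) = d →
        ∀ s : Fin d → (affineBlowup (Ideal.span ((fun b : Fin n →₀ ℕ => Ideal.Quotient.mk (Ideal.span {f}) (MvPolynomial.monomial b (1 : k))) '' (A : Set (Fin n →₀ ℕ))))).presheaf.stalk y, (Ideal.span (Set.range s)).radical.IsMaximal →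
          RingTheory.Sequence.IsWeaklyRegular ((affineBlowup (Ideal.span ((fun b : Fin n →₀ ℕ => Ideal.Quotient.mk (Ideal.span {f}) (MvPolynomial.monomial b (1 : k))) '' (A : Set (Fin n →₀ ℕ))))).presheaf.stalk y) (List.ofFn s) ∧
          ∀ z : (affineBlowup (Ideal.span ((fun b : Fin n →₀ ℕ => Ideal.Quotient.mk (Ideal.span {f}) (MvPolynomial.monomial b (1 : k))) '' (A : Set (Fin n →₀ ℕ))))).presheaf.stalk y, (∃ e : ℕ, z ^ p ^ e ∈
              Ideal.span ((fun w : (affineBlowup (Ideal.span ((fun b : Fin n →₀ ℕ => Ideal.Quotient.mk (Ideal.span {f}) (MvPolynomial.monomial b (1 : k))) '' (A : Set (Fin n →₀ ℕ))))).presheaf.stalk y => w ^ p ^ e) ''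
                (Ideal.span (Set.range s) : Set ((affineBlowup (Ideal.span ((fun b : Fin n →₀ ℕ => Ideal.Quotient.mk (Ideal.span {f}) (MvPolynomial.monomial b (1 : k))) '' (A : Set (Fin n →₀ ℕ))))).presheaf.stalk y)))) →
            z ∈ Ideal.span (Set.range s) := by
  haveI := hfprime
  haveI : IsDomain (MvPolynomial (Fin n) k ⧸ Ideal.span {f}) := Ideal.Quotient.isDomain _
  haveI : IsJacobsonRing (MvPolynomial (Fin n) k ⧸ Ideal.span {f}) := inferInstance
  haveI : CharP (MvPolynomial (Fin n) k ⧸ Ideal.span {f}) p :=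
    charP_of_injective_algebraMap (algebraMap k (MvPolynomial (Fin n) k ⧸ Ideal.span {f})).injective p
  -- names: the centre `I = I_A · R` and the covering sub-family `v c = x̄ ^ (m c)`
  obtain ⟨I, hI⟩ : ∃ I : Ideal (MvPolynomial (Fin n) k ⧸ Ideal.span {f}), I = Ideal.span ((fun b : Fin n →₀ ℕ => Ideal.Quotient.mk (Ideal.span {f}) (MvPolynomial.monomial b (1 : k))) '' (A : Set (Fin n →₀ ℕ))) := ⟨_, rfl⟩
  -- the same ideal written as an extension
  have hImap : I = (Ideal.span ((fun b : Fin n →₀ ℕ => (MvPolynomial.monomial b (1 : k) : MvPolynomial (Fin n) k)) '' (A : Set (Fin n →₀ ℕ)))).map (Ideal.Quotient.mk (Ideal.span {f})) := by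
    rw [hI, Ideal.map_span, Set.image_image]
  obtain ⟨v, hv⟩ : ∃ v : Fin t → MvPolynomial (Fin n) k ⧸ Ideal.span {f},
      v = fun c => Ideal.Quotient.mk (Ideal.span {f}) (MvPolynomial.monomial (m c) 1) := ⟨_, rfl⟩
  have hvI : ∀ c : Fin t, v c ∈ I := by
    intro c
    rw [hv, hI]
    exact Ideal.subset_span ⟨m c, hm c, rfl⟩
  have hv0 : ∀ c : Fin t, v c ≠ 0 := fun c => by
    rw [hv]
    exact CNConeFiModel.mk_monomial_ne_zero f hXne (m c)
  have hI0 : I ≠ ⊥ := fun h => hv0 ⟨0, ht⟩ (by simpa [h] using hvI ⟨0, ht⟩)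
  -- the centre lies in the ideal of the `J`-variables (every generator involves a `J`-variable)
  have hIle : I ≤ Ideal.span ((fun j : Fin n => Ideal.Quotient.mk (Ideal.span {f}) (MvPolynomial.X j)) '' (J : Set (Fin n))) := by
    rw [hImap, show ((fun j : Fin n => Ideal.Quotient.mk (Ideal.span {f}) (MvPolynomial.X j)) '' (J : Set (Fin n))) =
      Ideal.Quotient.mk (Ideal.span {f}) '' ((fun j : Fin n => (X j : MvPolynomial (Fin n) k)) '' (J : Set (Fin n))) from
      by rw [Set.image_image], ← Ideal.map_span]
    refine Ideal.map_mono ?_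
    rw [Ideal.span_le]
    rintro _ ⟨b, hb, rfl⟩
    obtain ⟨j, hj, hbj⟩ := hAJ b hb
    -- `x^b = X_j · x^(b - e_j)`
    have hXj : (X j : MvPolynomial (Fin n) k) ∈ Ideal.span ((fun j : Fin n => (X j : MvPolynomial (Fin n) k)) '' (J : Set (Fin n))) :=
      Ideal.subset_span ⟨j, hj, rfl⟩
    have hle : Finsupp.single j 1 ≤ b := by
      rw [Finsupp.single_le_iff]
      exact hbj
    have heq : (MvPolynomial.monomial b (1 : k) : MvPolynomial (Fin n) k) =
        MvPolynomial.monomial (b - Finsupp.single j 1) (1 : k) * X j := by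
      rw [X, monomial_mul, mul_one, tsub_add_cancel_of_le hle]
    show (MvPolynomial.monomial b (1 : k) : MvPolynomial (Fin n) k) ∈
      Ideal.span ((fun j : Fin n => (X j : MvPolynomial (Fin n) k)) '' (J : Set (Fin n)))
    rw [heq]
    exact Ideal.mul_mem_left _ _ hXj
  -- THE COVER, read off the identities `(x^a)^K = x^(m c) · y`
  have hcov' : (HomogeneousIdeal.irrelevant (reesGrading I)).toIdeal ≤
      (Ideal.span (Set.range fun c : Fin t => reesT (I := I) (v c) (hvI c))).radical := by
    refine ReesCoverOfPowers.stub_reesCoverOfPowers _ I (Ideal.Quotient.mk (Ideal.span {f}) '' ((fun b : Fin n →₀ ℕ => (MvPolynomial.monomial b (1 : k) : MvPolynomial (Fin n) k)) '' (A : Set (Fin n →₀ ℕ)))) (by rw [hImap, Ideal.map_span]) t v hvI ?_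
    rintro _ ⟨_, ⟨a, ha, rfl⟩, rfl⟩
    obtain ⟨c, K, hK, y, hy, hEq⟩ := hcov a ha
    refine ⟨c, K, hK, Ideal.Quotient.mk (Ideal.span {f}) y, ?_, ?_⟩
    · rw [hImap, ← Ideal.map_pow]
      exact Ideal.mem_map_of_mem _ hy
    · rw [hv]
      show _ = Ideal.Quotient.mk (Ideal.span {f}) (MvPolynomial.monomial (m c) 1) * _
      rw [← map_pow, hEq, map_mul]
  -- OFF THE CENTRE AND OVER `D(hbar)` (Jacobson, relative to `J`, avoiding `hbar`)
  have hoff' : ∀ (P : Ideal (MvPolynomial (Fin n) k ⧸ Ideal.span {f})) [P.IsPrime], ¬ I ≤ P → hbar ∉ P →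
      IsDomain (Localization.AtPrime P) ∧
      ∀ d : ℕ, ringKrullDim (Localization.AtPrime P) = d → ∀ s : Fin d → Localization.AtPrime P,
        (Ideal.span (Set.range s)).radical.IsMaximal →
          RingTheory.Sequence.IsWeaklyRegular (Localization.AtPrime P) (List.ofFn s) ∧
          ∀ y : Localization.AtPrime P, (∃ e : ℕ, y ^ p ^ e ∈ Ideal.span
            ((fun z : Localization.AtPrime P => z ^ p ^ e) ''
              (Ideal.span (Set.range s) : Set (Localization.AtPrime P)))) → y ∈ Ideal.span (Set.range s) := by
    intro P _ hP hhP
    -- some `x̄ⱼ ∉ P`, `j ∈ J` (else `I ≤ (x̄_J) ≤ P`)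
    have hj : ∃ j ∈ J, Ideal.Quotient.mk (Ideal.span {f}) (MvPolynomial.X j) ∉ P := by
      by_contra hcon
      push Not at hcon
      apply hP
      refine hIle.trans ?_
      rw [Ideal.span_le]
      rintro _ ⟨j, hj, rfl⟩
      exact hcon j hj
    obtain ⟨j, hj, hjP⟩ := hj
    -- a maximal `Q ⊇ P` missing `x̄ⱼ · hbar` (Jacobson)
    have hu : Ideal.Quotient.mk (Ideal.span {f}) (MvPolynomial.X j) * hbar ∉ P := fun hmem =>
      ((inferInstance : P.IsPrime).mem_or_mem hmem).elim hjP hhP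
    obtain ⟨Q, hQ, hPQ, huQ⟩ := BlowupFiModelOfCoverOpen.exists_isMaximal_le_notMem P hu
    haveI := hQ
    have hjQ : Ideal.Quotient.mk (Ideal.span {f}) (MvPolynomial.X j) ∉ Q := fun h1 => huQ (Q.mul_mem_right _ h1)
    have hhQ : hbar ∉ Q := fun h1 => huQ (Q.mul_mem_left _ h1)
    exact ClauseOfMaximal.fiClause_atPrime_of_le p hPQ ⟨inferInstance, hoff Q ⟨j, hj, hjQ⟩ hhQ⟩
  -- ON THE EXCEPTIONAL LOCUS, chart by chart
  have hon' : ∀ (c : Fin t) (Q : Ideal (blowupAlgebra I (v c))) [Q.IsMaximal],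
      algebraMap (MvPolynomial (Fin n) k ⧸ Ideal.span {f}) (blowupAlgebra I (v c)) (v c) ∈ Q →
      algebraMap (MvPolynomial (Fin n) k ⧸ Ideal.span {f}) (blowupAlgebra I (v c)) hbar ∉ Q →
      ∀ d : ℕ, ringKrullDim (Localization.AtPrime Q) = d → ∀ s : Fin d → Localization.AtPrime Q,
        (Ideal.span (Set.range s)).radical.IsMaximal →
          RingTheory.Sequence.IsWeaklyRegular (Localization.AtPrime Q) (List.ofFn s) ∧
          ∀ y : Localization.AtPrime Q, (∃ e : ℕ, y ^ p ^ e ∈ Ideal.span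
            ((fun z : Localization.AtPrime Q => z ^ p ^ e) ''
              (Ideal.span (Set.range s) : Set (Localization.AtPrime Q)))) → y ∈ Ideal.span (Set.range s) := by
    subst hI hv
    intro c Q _ hQ hhQ
    exact hon c Q hQ hhQ
  subst hI
  intro y hy
  exact BlowupFiModelOfCoverOpen.blowupClause_over_basicOpen p (MvPolynomial (Fin n) k ⧸ Ideal.span {f}) _ t v
    hvI hv0 hcov' hbar hoff' (fun c Q _ hQ hhQ => hon' c Q hQ hhQ) y hy

/-! ## §3 (G5ᴾ-rel = H3-rel) the global relative statement, an unconditional theorem schema -/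

set_option maxHeartbeats 800000 in
/-- **(H3-rel) `cnConeFiModelRel` — THE CN ENGINE RELATIVE TO A COORDINATE STRATUM: A THEOREM.** Data as in G5ᴾ
(`CNConeFiModelPrime.cnConeFiModel_of_isPrime`, p496198) except: `J ⊆ Fin n` non-empty; every exponent of `A` involves a `J`-variable;
(prim) is asked ON `J` ONLY (`X_j^e ∈ A` for `j ∈ J`); the clause off the centre is asked only at the maximal ideals OFF `V(X_J)`; the
Cartier–Newton faces are those of the row-subset weights strictly positive ON `J`. Conclusion = G5ᴾ's: `Spec k[X]/(f)` admits a proper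
birational model all of whose stalks are domains satisfying the crux clause (the blow-up of `I_A R`, covered by the vertex charts).
Per chart the landed prime presentation `k[y]/(g_c) ≃ R[I_A R/x̄^(m_c)]` (p495258) pulls a maximal `Q ∋ x̄^(m_c)/1` back to a maximal
`Q'` containing `θ(X_j)` for `j ∈ J` ((prim) on `J`: `(x̄ⱼ/1)^ε = (x̄ⱼ^ε/x̄^(m_c))·(x̄^(m_c)/1) ∈ Q`), the clause at `Q'` is
(G4ᴾ-rel) `cnChartClauseRel`, transported along the localised equivalence; then §2. [folklore] -/
theorem cnConeFiModelRelOpenH :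
    ∀ (p : ℕ) [Fact p.Prime] (k : Type) [Field k] [CharP k p] (n : ℕ) (J : Finset (Fin n)), J.Nonempty →
    ∀ (A : Finset (Fin n →₀ ℕ)), (∀ a ∈ A, ∃ j ∈ J, 0 < a j) →
    (∀ j ∈ J, ∃ e : ℕ, 0 < e ∧ Finsupp.single j e ∈ A) →
    ∀ (t : ℕ), 0 < t → ∀ (V : Fin t → Matrix (Fin n) (Fin n) ℕ), (∀ c, IsUnit ((V c).map (Nat.cast : ℕ → ℤ)).det) →
    ∀ (m : Fin t → (Fin n →₀ ℕ)), (∀ c, m c ∈ A) →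
    ∀ (a : Fin t → Fin n → (Fin n →₀ ℕ)), (∀ c i, a c i ∈ A) →
    (∀ (c : Fin t) (i : Fin n), (Finsupp.equivFunOnFinite.symm ((V c).mulVec ⇑(a c i)) : Fin n →₀ ℕ) =
      Finsupp.equivFunOnFinite.symm ((V c).mulVec ⇑(m c)) + Finsupp.single i 1) →
    (∀ (c : Fin t), ∀ e ∈ A, (Finsupp.equivFunOnFinite.symm ((V c).mulVec ⇑(m c)) : Fin n →₀ ℕ) ≤
      Finsupp.equivFunOnFinite.symm ((V c).mulVec ⇑e)) →
    (∀ e ∈ A, ∃ (c : Fin t) (K : ℕ), 1 ≤ K ∧ ∃ y ∈ (Ideal.span ((fun b : Fin n →₀ ℕ => (MvPolynomial.monomial b (1 : k) : MvPolynomial (Fin n) k)) '' (A : Set (Fin n →₀ ℕ)))) ^ (K - 1),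
      (MvPolynomial.monomial e (1 : k) : MvPolynomial (Fin n) k) ^ K = MvPolynomial.monomial (m c) 1 * y) →
    ∀ (f : MvPolynomial (Fin n) k), (Ideal.span {f}).IsPrime →
    (∀ v : Fin n, Ideal.Quotient.mk (Ideal.span {f}) (MvPolynomial.X v) ≠ 0) →
    ∀ (h : MvPolynomial (Fin n) k),
    (∀ (Q : Ideal (MvPolynomial (Fin n) k ⧸ Ideal.span {f})) [Q.IsMaximal],
      (∃ j ∈ J, Ideal.Quotient.mk (Ideal.span {f}) (MvPolynomial.X j) ∉ Q) → Ideal.Quotient.mk (Ideal.span {f}) h ∉ Q →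
      ∀ d : ℕ, ringKrullDim (Localization.AtPrime Q) = d → ∀ s : Fin d → Localization.AtPrime Q,
        (Ideal.span (Set.range s)).radical.IsMaximal →
          RingTheory.Sequence.IsWeaklyRegular (Localization.AtPrime Q) (List.ofFn s) ∧
          ∀ y : Localization.AtPrime Q, (∃ e : ℕ, y ^ p ^ e ∈ Ideal.span
            ((fun z : Localization.AtPrime Q => z ^ p ^ e) ''
              (Ideal.span (Set.range s) : Set (Localization.AtPrime Q)))) → y ∈ Ideal.span (Set.range s)) →
    (∀ (c : Fin t) (S : Finset (Fin n)), (∀ j ∈ J, 0 < ∑ i ∈ S, V c i j) →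
      (∀ D : ℕ, (MvPolynomial.weightedHomogeneousComponent (fun j : Fin n => ∑ i ∈ S, V c i j) D f ≠ 0 ∧
          ∀ D' < D, MvPolynomial.weightedHomogeneousComponent (fun j : Fin n => ∑ i ∈ S, V c i j) D' f = 0) →
        ∀ (K : Type) [Field K] [CharP K p] [Algebra k K] (a : Fin n → K), (∀ i, i ∈ S ↔ a i = 0) →
          MvPolynomial.aeval a (MvPolynomial.aeval (fun j : Fin n => ∏ i : Fin n, (MvPolynomial.X i : MvPolynomial (Fin n) k) ^ V c i j) h) ≠ 0 →
          MvPolynomial.aeval (fun j : Fin n => ∏ i : Fin n, (if i ∈ S then (1 : K) else a i) ^ V c i j)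
            (MvPolynomial.weightedHomogeneousComponent (fun j : Fin n => ∑ i ∈ S, V c i j) D f) = 0 →
          (MvPolynomial.map (algebraMap k K) (MvPolynomial.weightedHomogeneousComponent (fun j : Fin n => ∑ i ∈ S, V c i j) D f)) ^ (p - 1) ∉
            Ideal.span (Set.range fun i : Fin n => (MvPolynomial.X i - MvPolynomial.C (∏ i' : Fin n, (if i' ∈ S then (1 : K) else a i') ^ V c i' i)) ^ p))) →
    ∀ (dv : Fin t → (Fin n →₀ ℕ)) (g : Fin t → MvPolynomial (Fin n) k),
    (∀ c, MvPolynomial.aeval (fun j : Fin n => ∏ i : Fin n, (MvPolynomial.X i : MvPolynomial (Fin n) k) ^ V c i j) f = MvPolynomial.monomial (dv c) 1 * g c) →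
    (∀ c, ∀ i : Fin n, ¬ (MvPolynomial.X i ∣ g c)) →
    (∀ c, ∃ m ∈ f.support, ∀ i : Fin n, ∑ j : Fin n, V c i j * m j = dv c i) →
    ∀ y : ↥(affineBlowup (Ideal.span ((fun b : Fin n →₀ ℕ => Ideal.Quotient.mk (Ideal.span {f}) (MvPolynomial.monomial b (1 : k))) '' (A : Set (Fin n →₀ ℕ))))),
      (affineBlowup.π (Ideal.span ((fun b : Fin n →₀ ℕ => Ideal.Quotient.mk (Ideal.span {f}) (MvPolynomial.monomial b (1 : k))) '' (A : Set (Fin n →₀ ℕ))))).base y ∈ PrimeSpectrum.basicOpen (Ideal.Quotient.mk (Ideal.span {f}) h) →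
      IsDomain ((affineBlowup (Ideal.span ((fun b : Fin n →₀ ℕ => Ideal.Quotient.mk (Ideal.span {f}) (MvPolynomial.monomial b (1 : k))) '' (A : Set (Fin n →₀ ℕ))))).presheaf.stalk y) ∧
      ∀ d : ℕ, ringKrullDim ((affineBlowup (Ideal.span ((fun b : Fin n →₀ ℕ => Ideal.Quotient.mk (Ideal.span {f}) (MvPolynomial.monomial b (1 : k))) '' (A : Set (Fin n →₀ ℕ))))).presheaf.stalk y) = d →
        ∀ s : Fin d → (affineBlowup (Ideal.span ((fun b : Fin n →₀ ℕ => Ideal.Quotient.mk (Ideal.span {f}) (MvPolynomial.monomial b (1 : k))) '' (A : Set (Fin n →₀ ℕ))))).presheaf.stalk y, (Ideal.span (Set.range s)).radical.IsMaximal →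
          RingTheory.Sequence.IsWeaklyRegular ((affineBlowup (Ideal.span ((fun b : Fin n →₀ ℕ => Ideal.Quotient.mk (Ideal.span {f}) (MvPolynomial.monomial b (1 : k))) '' (A : Set (Fin n →₀ ℕ))))).presheaf.stalk y) (List.ofFn s) ∧
          ∀ z : (affineBlowup (Ideal.span ((fun b : Fin n →₀ ℕ => Ideal.Quotient.mk (Ideal.span {f}) (MvPolynomial.monomial b (1 : k))) '' (A : Set (Fin n →₀ ℕ))))).presheaf.stalk y, (∃ e : ℕ, z ^ p ^ e ∈
              Ideal.span ((fun w : (affineBlowup (Ideal.span ((fun b : Fin n →₀ ℕ => Ideal.Quotient.mk (Ideal.span {f}) (MvPolynomial.monomial b (1 : k))) '' (A : Set (Fin n →₀ ℕ))))).presheaf.stalk y => w ^ p ^ e) ''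
                (Ideal.span (Set.range s) : Set ((affineBlowup (Ideal.span ((fun b : Fin n →₀ ℕ => Ideal.Quotient.mk (Ideal.span {f}) (MvPolynomial.monomial b (1 : k))) '' (A : Set (Fin n →₀ ℕ))))).presheaf.stalk y)))) →
            z ∈ Ideal.span (Set.range s) := by
  intro p _ k _ _ n J hJ A hAJ hprim t ht V hV m hm a haA hgen hge hcov f hfprime hXne h hoff hCN dv g hg hndiv hface
  refine cnConeFiModelRelOpenH_of_chartClause p k n J A hAJ t ht m hm hcov f hfprime hXne (Ideal.Quotient.mk (Ideal.span {f}) h) hoff ?_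
  intro c Q _ hQ hhQ
  haveI := hfprime
  haveI : IsDomain (MvPolynomial (Fin n) k ⧸ Ideal.span {f}) := Ideal.Quotient.isDomain _
  obtain ⟨j₀, hj₀⟩ := hJ
  have hg0 : g c ≠ 0 := fun h0 => hndiv c j₀ (h0 ▸ dvd_zero _)
  -- the presentation of chart `c` (C1 prime form, landed), upgraded to a ring equivalence
  obtain ⟨e₀, hbij, heθ⟩ := MonomialChartPresentationPrime.exists_monomialChartPresentation_of_isPrime f (V c) (hV c) (m c) (a c)
    (hgen c) A (haA c) (hge c) (dv c) (g c) (hg c) hfprime hXne (hndiv c)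
  obtain ⟨e, he⟩ : ∃ e : (MvPolynomial (Fin n) k ⧸ Ideal.span {g c}) ≃+* ↥(blowupAlgebra (Ideal.span ((fun b : Fin n →₀ ℕ => Ideal.Quotient.mk (Ideal.span {f}) (MvPolynomial.monomial b (1 : k))) '' (A : Set (Fin n →₀ ℕ)))) (Ideal.Quotient.mk (Ideal.span {f}) (MvPolynomial.monomial (m c) 1))),
      ∀ x, e x = e₀ x := ⟨RingEquiv.ofBijective e₀ hbij, fun x => rfl⟩
  -- `(g c)` is prime: `k[y]/(g c)` is isomorphic to a subring of the domain `R[1/x̄^(m c)]`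
  haveI : IsDomain (Localization.Away (Ideal.Quotient.mk (Ideal.span {f}) (MvPolynomial.monomial (m c) (1 : k)))) :=
    IsLocalization.isDomain_localization
      (powers_le_nonZeroDivisors_of_noZeroDivisors (CNConeFiModel.mk_monomial_ne_zero f hXne (m c)))
  haveI : IsDomain (MvPolynomial (Fin n) k ⧸ Ideal.span {g c}) := e.toMulEquiv.isDomain
  haveI hgp : (Ideal.span {g c}).IsPrime := (Ideal.Quotient.isDomain_iff_prime _).mp inferInstance
  -- `Q' = e⁻¹ Q` is maximal
  haveI hQ' : (Q.comap e.toRingHom).IsMaximal := Ideal.comap_isMaximal_of_equiv e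
  -- every `θ(X_j)`, `j ∈ J`, lies in `Q'`: `(x̄ⱼ/1)^ε = (x̄ⱼ^ε/x̄^m) · (x̄^m/1) ∈ Q` ((prim) on `J`)
  have hXQ : ∀ j ∈ J,
      Ideal.Quotient.mk (Ideal.span {g c}) (∏ i : Fin n, MvPolynomial.X i ^ V c i j) ∈ Q.comap e.toRingHom := by
    intro j hj
    obtain ⟨ε, hε, hεA⟩ := hprim j hj
    have hz : algebraMap (MvPolynomial (Fin n) k ⧸ Ideal.span {f}) (Localization.Away (Ideal.Quotient.mk (Ideal.span {f}) (MvPolynomial.monomial (m c) (1 : k))))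
        (Ideal.Quotient.mk (Ideal.span {f}) (MvPolynomial.X j ^ ε)) * IsLocalization.Away.invSelf (Ideal.Quotient.mk (Ideal.span {f}) (MvPolynomial.monomial (m c) (1 : k))) ∈
        blowupAlgebra (Ideal.span ((fun b : Fin n →₀ ℕ => Ideal.Quotient.mk (Ideal.span {f}) (MvPolynomial.monomial b (1 : k))) '' (A : Set (Fin n →₀ ℕ)))) (Ideal.Quotient.mk (Ideal.span {f}) (MvPolynomial.monomial (m c) 1)) := by
      refine div_mem_blowupAlgebra _ _ (Ideal.subset_span ⟨Finsupp.single j ε, hεA, ?_⟩)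
      show Ideal.Quotient.mk (Ideal.span {f}) (MvPolynomial.monomial (Finsupp.single j ε) (1 : k)) = _
      rw [X_pow_eq_monomial]
    have hprod : (⟨_, hz⟩ : ↥(blowupAlgebra (Ideal.span ((fun b : Fin n →₀ ℕ => Ideal.Quotient.mk (Ideal.span {f}) (MvPolynomial.monomial b (1 : k))) '' (A : Set (Fin n →₀ ℕ)))) (Ideal.Quotient.mk (Ideal.span {f}) (MvPolynomial.monomial (m c) 1)))) *
        algebraMap (MvPolynomial (Fin n) k ⧸ Ideal.span {f}) _ (Ideal.Quotient.mk (Ideal.span {f}) (MvPolynomial.monomial (m c) 1)) =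
        (algebraMap (MvPolynomial (Fin n) k ⧸ Ideal.span {f}) _ (Ideal.Quotient.mk (Ideal.span {f}) (MvPolynomial.X j))) ^ ε := by
      apply Subtype.ext
      simp only [Subalgebra.coe_mul, Subalgebra.coe_algebraMap, SubmonoidClass.coe_pow]
      rw [← map_pow, ← map_pow]
      exact div_mul_algebraMap _ _
    have hmem : (algebraMap (MvPolynomial (Fin n) k ⧸ Ideal.span {f}) ↥(blowupAlgebra (Ideal.span ((fun b : Fin n →₀ ℕ => Ideal.Quotient.mk (Ideal.span {f}) (MvPolynomial.monomial b (1 : k))) '' (A : Set (Fin n →₀ ℕ)))) (Ideal.Quotient.mk (Ideal.span {f}) (MvPolynomial.monomial (m c) 1))) (Ideal.Quotient.mk (Ideal.span {f}) (MvPolynomial.X j))) ^ ε ∈ Q := by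
      rw [← hprod]
      exact Q.mul_mem_left _ hQ
    have hXjQ := (inferInstance : Q.IsPrime).mem_of_pow_mem _ hmem
    rw [Ideal.mem_comap]
    have hej : e.toRingHom (Ideal.Quotient.mk (Ideal.span {g c}) (∏ i : Fin n, MvPolynomial.X i ^ V c i j)) =
        algebraMap (MvPolynomial (Fin n) k ⧸ Ideal.span {f}) ↥(blowupAlgebra (Ideal.span ((fun b : Fin n →₀ ℕ => Ideal.Quotient.mk (Ideal.span {f}) (MvPolynomial.monomial b (1 : k))) '' (A : Set (Fin n →₀ ℕ)))) (Ideal.Quotient.mk (Ideal.span {f}) (MvPolynomial.monomial (m c) 1))) (Ideal.Quotient.mk (Ideal.span {f}) (MvPolynomial.X j)) := by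
      apply Subtype.ext
      rw [Subalgebra.coe_algebraMap]
      have h1 := heθ (MvPolynomial.X j)
      rw [MvPolynomial.aeval_X] at h1
      rw [RingEquiv.toRingHom_eq_coe, RingHom.coe_coe, he]
      exact h1
    rw [hej]
    exact hXjQ
  -- the clause at `Q'` (G4ᴾ-rel), transported along `k[y]/(g c)_(Q') ≅ (chart)_Q`
  -- `θ(h)` does not lie in `Q'`: `e (θ h mod g) = h̄/1 ∉ Q`
  have hhQ' : Ideal.Quotient.mk (Ideal.span {g c})
      (MvPolynomial.aeval (fun j : Fin n => ∏ i : Fin n, (MvPolynomial.X i : MvPolynomial (Fin n) k) ^ V c i j) h) ∉ Q.comap e.toRingHom := by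
    have hej : e.toRingHom (Ideal.Quotient.mk (Ideal.span {g c})
        (MvPolynomial.aeval (fun j : Fin n => ∏ i : Fin n, (MvPolynomial.X i : MvPolynomial (Fin n) k) ^ V c i j) h)) =
        algebraMap (MvPolynomial (Fin n) k ⧸ Ideal.span {f}) _ (Ideal.Quotient.mk (Ideal.span {f}) h) := by
      apply Subtype.ext
      rw [Subalgebra.coe_algebraMap, RingEquiv.toRingHom_eq_coe, RingHom.coe_coe, he]
      exact heθ h
    rw [Ideal.mem_comap, hej]
    exact hhQ
  have hcl := CNChartClauseRelOpen.cnChartClauseRelOpen p k n J ⟨j₀, hj₀⟩ f (V c) (hV c) (dv c) (g c) hgp h (hg c) hg0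
    (fun S hS => hCN c S hS) (hface c) (Q.comap e.toRingHom) hXQ hhQ'
  obtain ⟨eL⟩ := BlowupFiModelOfCover.nonempty_ringEquiv_localization_of_ringEquiv e (Q.comap e.toRingHom) Q
    (fun x => Iff.rfl)
  exact DegreeZeroDescent.inlineClause_of_ringEquiv p eL hcl


end Summit.ResolutionOfSingularities.ResolutionOfSingularities.Theorems.FInjectiveMacaulayfication.CNConeFiModelRelOpenH

end
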